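import Literature.Geometry.Lorentzian.CoordRicciWaveGauge
import Mathlib.Algebra.BigOperators.Fin
import Mathlib.Analysis.Complex.Basic
import Mathlib.Tactic
import HarnessLib

/-!
# Hintz 2026, Prop 5.25 (`PropExID`, gauged Cauchy data) versus its refereed source Hintz–Vasy 2018
# Prop 3.10: the pointwise algebra PROVED in the tree's coordinate tensor calculus, the triangular
# determination of `h̃₁`, and the printed `(𝓔₀, ℓ₀)` bookkeeping (incl. the Thm 13.1 Step 2 edge)

CITATION HEADER (lean-in-tree rule 2026-08-18).  P. Hintz, *Nonlinear stability of subextremal Kerr black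
holes*, arXiv:2606.28253 **v2** (2026-08-03), bib key `Hintz2026` — an UNREFEREED CLAIM under adjudication in
this library; TeX line numbers `l.N` refer to the v2 source `kerr-stab-r.tex`.  The REFEREED source whose
construction Prop 5.25 transplants is P. Hintz, A. Vasy, *The global non-linear stability of the Kerr–de Sitter
family of black holes*, Acta Math. **220** (2018) 1–206, **Prop. 3.10** and its proof (§3.5 of the arXiv text
1606.04014 = corpus `paper:arxiv-1606.04014` chunk p0024; gauge 1-form: Remark 2.1), bib `HintzVasy2018`
("HV18").  Hintz 2026 l.5736: "This is very similar to [HV18, Proposition 3.10] and [Hintz–Vasy, arXiv:2409.15460,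
Theorem 4.2]; the only additional feature here is the need to keep track of index sets and decay as `r → ∞`"
(the second template, bib `HintzVasy2024` "HV24", Thm 4.2 proof Step 1, is a preprint and is word for word the
model of Prop 5.25's proof).  This module is the audit cell `pub-kerr`'s HINTZ-PLAN item R7 remainder / P16
(deliverable (c): typed interface of the Hintz route to its refereed leaves).  What Prop 5.25 asserts beyond
HV18 is function-space bookkeeping in weighted, partially polyhomogeneous b-Sobolev classes; what it shares with
HV18 is a pointwise computation, which we PROVE here from first principles:

* §1 (`perturb`, `koszulCLM_perturb`, `apply_chrAt_perturb_sub`): for metric components `g₀` and a symmetric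
  `h̃` on a chart `E` and a function `t` with `t(x) = 0`, the Koszul form / Christoffel map of `g₀ + t·h̃` at `x`
  (the tree's `MetricCoord.koszulCLM` / `chrAt`, O'Neill's `Γ`) differ from those of `g₀` by the PRINTED first
  variation `2(Γ₁ − Γ₀)_{λμν} = t_{;μ}h̃_{νλ} + t_{;ν}h̃_{μλ} − t_{;λ}h̃_{μν}` (Hintz l.5760 = HV18's coordinate
  display), derived from the Leibniz rule `D(t·h̃)(x) = dt ⊗ h̃(x)`; hence `g₀((∇¹_X − ∇⁰_X)Y, N) = ½(…)`, and for
  tangential `X, Y` (`Xt = Yt = 0`) the value `−½ (N t) h̃(X,Y)` (l.5762, sign included) and HV18's polarised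
  display;
* §2 (`upsilon0`, `upsilon0_perturb_sub`, `sum_ginv_koszulVar_eq`): the gauge 1-form
  `Υ₀(g,g⁰)(W) = Σ g^{κλ} g(Γ_g(b_κ,b_λ) − Γ_{g⁰}(b_κ,b_λ), W)` (Hintz eq. (4.x) `Eq1Ups0` = HV18 Remark 2.1),
  its link with the tree's wave-gauge functional `MetricCoord.gaugeFun`, and its first variation: the background
  CANCELS (this is (5.x) `EqExIDGauge`), and the basis sum equals HV18's trace-reversal form
  `h̃(∇t, W) − ½ (W t) tr_{g₀} h̃ = (𝖦_{g₀} h̃)(∇t, W)` (eq. `EqKdSInGaugeCond`);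
* §3 (`sffVar`, `gaugeVar`, `solve`, `existsUnique_solution`): in an ADAPTED frame (`e₀ t = τ ≠ 0`,
  `e_i t = 0`, `g^{00} ≠ 0`) the `½n(n+1) + (n+1)` linear conditions "second fundamental form components `= κ`"
  and "gauge components `= f`" determine the symmetric `h̃₁ ∈ S²` UNIQUELY, with the printed triangular
  formulas (`(ij) → (0j) → (00)`, l.5762–5766; the `g^{0i}` cross terms cancel in the `λ = 0` equation,
  `gaugeVar_tcomp_zero`), for every spatial dimension `n` (print: `n = 3`); in the printed normalisation
  `g^{00} = −1`, `g^{0i} = 0` (`e₀ = ν`, `e_i ⊥ ν`: §3b `ginv_zero_zero_eq_neg_one`, `ginv_zero_succ`) the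
  last sentence of the proof is reproduced verbatim (`gaugeVar_tcomp_zero_unitNormal`); the solution map is
  linear in the data and vanishes at zero data (the algebraic half of "depending continuously … and equal to
  `0` when `(γ̃, k̃) = (0,0)`", l.5729); §3b transports §§1–2 to frame components (`hcomp_eq_solve`) and proves
  HV18's "`∇^{g₀}t_*` is a non-zero scalar multiple of `N`" (`sharpAt_dt_eq_smul`);
* §4 (`PhgOrder`): the printed orders as an `ℕ × ℝ` ledger — data `γ̃ ∈ (𝓔₀,ℓ₀)`, `k̃ ∈ (𝓔₀+1,ℓ₀+1)`, each
  `x`-derivative / Kerr-Christoffel factor gains `(1,1)` (l.5751), all four right-hand-side terms of (EqExIDk)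
  land in `(𝓔₀+1,ℓ₀+1)` (`rhsTerms_eq`), `h₁ = r h̃₁` returns to `(𝓔₀,ℓ₀)` = the claimed (5.x) `EqExIDhj`
  (`mulR_ofDataK`); and the EDGE Thm 13.1 Step 2 (l.15124) → Prop 5.25 at `ℓ₀ = 3 + ε₀`: hypothesis (13.x)
  `EqStMem` (l.15046–15049) is literally Prop 5.25's data class, `min Re 𝓔₀ > 1+ε₀ > 0`, smallness index `3 ≤ d`
  (`step2_edge`, `step2_minRe`, `step2_smallness`);
* §5 (`IsIndexSet`, `isum`, `ishift`, `nfold`, `NonlinearlyClosed`): Hintz's index sets (Def 2.7 `DefTMIndex`,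
  l.2360–2379) with the closure fact used at l.5751 — for nonlinearly closed `𝓔₀`, `(𝓔₀+1) + 𝓔₀ ⊆ 𝓔₀+1`
  (`isum_ishift_subset`) — and `𝓔₀ = ∅` admissible (Example 5.27 `ExIDPhg` (1), l.5829).

NOT asserted here (audit items R7.d of HINTZ-PLAN P16, all function-space statements of the unrefereed text):
that `ν̃ ∈ H_b^{∞,(𝓔₀,ℓ₀)}`, that b-regularity gives the `r⁻¹` gain, that the classes are `𝒞^∞`-modules /
closed under the products and the division by `e₀ t` used, and Hintz's Lemma 3.13 (`LemmaKMetData`) decay of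
the Kerr Christoffel symbols; nor anything about HV24.  PRINT-LEVEL DATA recorded in the cell's DIVERGENCE.md
(SRC-A17/18): the proof's `k(X,Y) = g(∇^g_X Y, ν₀)` (l.5744, = HV18 §2.1's convention `k(X,Y) = ⟨∇_X Y, N⟩`) is
the OPPOSITE sign of the paper's own Def 3.12 `DefKMetData` (l.3810, `k_b(V,W) := g_b(∇_V ν_b, W)`), immaterial
for the statement (the linear system is uniquely solvable for either sign of the `k̃`-term: `existsUnique_solution`
quantifies over all `κ`); and "`g⁰`" in l.5758–5766 denotes the proof's `g₀ = g_{b₀} + h₀`, not the background.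
No `Prop`-valued definition asserting a result — i.e. no named fact (D-0026); the only `Prop`-valued definitions
are the two PREDICATES `IsIndexSet` and `NonlinearlyClosed` (notions with arguments and bodies, each with proved API
lemmas), never taken as hypotheses of a statement about Hintz's theorem; every `def` has a body; imports
Literature/Mathlib only. (Wording sharpened after the cell's REFEREE #47, precision P18.)

## References
* P. Hintz, arXiv:2606.28253v2 (2026): Prop 5.25 `PropExID` l.5717–5734, proof l.5735–5766; Def 4.1 /
  eq. (Eq1Ups0) l.4154–4166; Def 2.7 (DefTMIndex) l.2360–2379; Thm 13.1 (EqStMem) l.15046–15049, Step 2 l.15124;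
  §5.6.1 l.5788; Example 5.27 (ExIDPhg) l.5829; Lemma 3.13 (LemmaKMetData) l.3821–3846. [Hintz2026]
* P. Hintz, A. Vasy, Acta Math. 220 (2018) 1–206, Remark 2.1 and Prop 3.10 with proof
  (arXiv:1606.04014, §2.1 and §3.5). [HintzVasy2018]
* P. Hintz, A. Vasy, arXiv:2409.15460 (2024), Thm 4.2, proof Step 1. [HintzVasy2024]
* B. O'Neill, *Semi-Riemannian geometry*, Academic Press 1983, Ch. 3, Prop. 3.13 (the tree's
  `MetricCoord` conventions). [ONeill1983]
-/

noncomputable section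

set_option maxSynthPendingDepth 3

open Set Filter ContinuousLinearMap Module Finset
open scoped Topology

namespace Literature.Geometry.Lorentzian

namespace Hintz2026.GaugedCauchyData

open MetricCoord

variable {E : Type*} [NormedAddCommGroup E] [NormedSpace ℝ E]

/-! ### §1 The first variation of the Levi-Civita connection of `g₀ + t·h̃` at `{t = 0}` -/

/-- The components of the one-parameter perturbation `g₀ + t·h̃₁` of Prop 5.25's proof (l.5742:
"for `g := g₀ + r⁻¹ t_IVP h₁ = g₀ + t_IVP h̃₁`") as a field of bilinear forms: `y ↦ G₀ y + t(y)·H y`;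
the same object as HV18's `g₀ + t_* g₁`. [cite: Hintz2026, Prop 5.25 proof TeX l.5742 (transcription; claim under review)] -/
def perturb (G₀ H : E → E →L[ℝ] E →L[ℝ] ℝ) (t : E → ℝ) : E → E →L[ℝ] E →L[ℝ] ℝ :=
  fun y ↦ G₀ y + t y • H y

/-- Unfolding lemma for `perturb`. [folklore] -/
@[simp]
theorem perturb_apply (G₀ H : E → E →L[ℝ] E →L[ℝ] ℝ) (t : E → ℝ) (y : E) :
    perturb G₀ H t y = G₀ y + t y • H y := rfl

variable {G₀ H Gb : E → E →L[ℝ] E →L[ℝ] ℝ} {t : E → ℝ} {x : E} {dt : E →L[ℝ] ℝ}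

/-- On the initial surface `{t = 0}` the perturbed components coincide with `g₀`'s ("which still
has unit normal `ν₀`", l.5742). [folklore] -/
theorem perturb_eq_of_eq_zero (ht : t x = 0) : perturb G₀ H t x = G₀ x := by
  simp [perturb, ht]

/-- **Leibniz rule at the initial surface**: at a point with `t(x) = 0`,
`D(g₀ + t·h̃)(x) = Dg₀(x) + dt ⊗ h̃(x)` — the `t·Dh̃` term drops. [folklore] -/
theorem hasFDerivAt_perturb {G' H' : E →L[ℝ] E →L[ℝ] E →L[ℝ] ℝ}
    (hG : HasFDerivAt G₀ G' x) (hH : HasFDerivAt H H' x) (hdt : HasFDerivAt t dt x)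
    (ht : t x = 0) : HasFDerivAt (perturb G₀ H t) (G' + dt.smulRight (H x)) x := by
  have h := hG.add (hdt.smul hH)
  rw [ht, zero_smul, zero_add] at h
  exact h

/-- Componentwise form of `hasFDerivAt_perturb`: `∂_v (g₀ + t h̃)(Y,Z) = ∂_v g₀(Y,Z) + (v t) h̃(Y,Z)`
at `{t = 0}`. [folklore] -/
theorem fderiv_perturb_apply₃ (hG : DifferentiableAt ℝ G₀ x) (hH : DifferentiableAt ℝ H x)
    (hdt : HasFDerivAt t dt x) (ht : t x = 0) (v Y Z : E) :
    fderiv ℝ (perturb G₀ H t) x v Y Z = fderiv ℝ G₀ x v Y Z + dt v * H x Y Z := by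
  rw [(hasFDerivAt_perturb hG.hasFDerivAt hH.hasFDerivAt hdt ht).fderiv]
  simp only [add_apply, ContinuousLinearMap.smulRight_apply, smul_apply, smul_eq_mul]

/-- **The printed variation of the Christoffel symbols of the first kind** (doubled): for a
covector `dt` and a bilinear form `h`,
`koszulVar dt h X Y Z = dt(X) h(Y,Z) + dt(Y) h(Z,X) − dt(Z) h(X,Y)`. With `(X,Y,Z) = (e_μ, e_ν, e_λ)`
this is Hintz's `t_{;μ} h̃_{νλ} + t_{;ν} h̃_{μλ} − t_{;λ} h̃_{μν} = 2(Γ(g₀+t h̃)_{λμν} − Γ(g₀)_{λμν})`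
(l.5760) and HV18's `(∂_μ t_*)(g₁)_{νλ} + (∂_ν t_*)(g₁)_{μλ} − (∂_λ t_*)(g₁)_{μν}` (proof of
Prop 3.10, "in a local coordinate system, one computes").
[cite: Hintz2026, Prop 5.25 proof TeX l.5760 (transcription; claim under review)] -/
def koszulVar (dt : E →L[ℝ] ℝ) (h : E →L[ℝ] E →L[ℝ] ℝ) (X Y Z : E) : ℝ :=
  dt X * h Y Z + dt Y * h Z X - dt Z * h X Y

/-- **The Koszul form of `g₀ + t h̃` at `{t = 0}`** is that of `g₀` plus the printed variation:
`K₁(X,Y,Z) = K₀(X,Y,Z) + koszulVar dt h̃ X Y Z` — i.e. `2(Γ₁ − Γ₀)_{λμν} = t_{;μ}h̃_{νλ} + t_{;ν}h̃_{μλ}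
− t_{;λ}h̃_{μν}`, DERIVED from the Leibniz rule (HV18 Prop 3.10 proof; Hintz l.5760).
[cite: HintzVasy2018, Prop 3.10 (proof, coordinate display)] -/
theorem koszulCLM_perturb (hG : DifferentiableAt ℝ G₀ x) (hH : DifferentiableAt ℝ H x)
    (hdt : HasFDerivAt t dt x) (ht : t x = 0) (X Y Z : E) :
    koszulCLM (perturb G₀ H t) x X Y Z = koszulCLM G₀ x X Y Z + koszulVar dt (H x) X Y Z := by
  simp only [koszulCLM_apply, fderiv_perturb_apply₃ hG hH hdt ht, koszulVar]
  ring

/-- Index raising at `{t = 0}` is that of `g₀`. [folklore] -/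
theorem sharpAt_perturb (ht : t x = 0) : sharpAt (perturb G₀ H t) x = sharpAt G₀ x := by
  change (perturb G₀ H t x).inverse = (G₀ x).inverse
  rw [perturb_eq_of_eq_zero ht]

/-- **Second-fundamental-form variation, general vectors**:
`g₀((∇^{g₀+t h̃}_X − ∇^{g₀}_X) Y, N) = ½ (dt(X) h̃(Y,N) + dt(Y) h̃(N,X) − dt(N) h̃(X,Y))` at
`{t = 0}` — the left-hand side of Hintz's (5.x) `EqExIDk` (l.5749) and of HV18's (3.x) `EqKdSInG1`,
computed. [cite: HintzVasy2018, Prop 3.10 (proof)] -/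
theorem apply_chrAt_perturb_sub (hx : (G₀ x).IsInvertible) (hG : DifferentiableAt ℝ G₀ x)
    (hH : DifferentiableAt ℝ H x) (hdt : HasFDerivAt t dt x) (ht : t x = 0) (X Y N : E) :
    G₀ x (chrAt (perturb G₀ H t) x X Y - chrAt G₀ x X Y) N = 2⁻¹ * koszulVar dt (H x) X Y N := by
  have hx' : (perturb G₀ H t x).IsInvertible := by rwa [perturb_eq_of_eq_zero ht]
  have h1 : G₀ x (chrAt (perturb G₀ H t) x X Y) N = 2⁻¹ * koszulCLM (perturb G₀ H t) x X Y N := by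
    have := apply_chrAt (G := perturb G₀ H t) hx' X Y N
    rwa [perturb_eq_of_eq_zero ht] at this
  rw [map_sub, sub_apply, h1, apply_chrAt hx, koszulCLM_perturb hG hH hdt ht]
  ring

/-- **Tangential vectors** (`X t = Y t = 0`, i.e. `X, Y ∈ TΣ`): the variation is
`−½ (N t) h̃(X,Y)` — Hintz l.5762 "The left-hand side of (EqExIDk) for `(X,Y) = (e_i,e_j)` thus
equals `−½(e₀ t_IVP)(h̃₁)_{ij}`". [cite: Hintz2026, Prop 5.25 proof TeX l.5762 (claim under review; here proved)] -/
theorem apply_chrAt_perturb_sub_of_tangential (hx : (G₀ x).IsInvertible)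
    (hG : DifferentiableAt ℝ G₀ x) (hH : DifferentiableAt ℝ H x) (hdt : HasFDerivAt t dt x)
    (ht : t x = 0) {X Y : E} (hX : dt X = 0) (hY : dt Y = 0) (N : E) :
    G₀ x (chrAt (perturb G₀ H t) x X Y - chrAt G₀ x X Y) N = -(2⁻¹ * dt N * H x X Y) := by
  rw [apply_chrAt_perturb_sub hx hG hH hdt ht, koszulVar, hX, hY]
  ring

/-- **HV18's polarised form**: for `h̃` symmetric,
`2 g₀((∇¹_X − ∇⁰_X)X, N) = 2 (X t) h̃(X,N) − (N t) h̃(X,X)` — the display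
`2(X t_*)g₁(X,N) − (N t_*)g₁(X,X) = 2(k(X,X) − g₀(∇^{g₀}_X X, N))` of the proof of Prop 3.10
("hence by polarization (EqKdSInG1) is equivalent to"). [cite: HintzVasy2018, Prop 3.10 (proof, polarised display)] -/
theorem two_mul_apply_chrAt_perturb_sub_self (hx : (G₀ x).IsInvertible)
    (hG : DifferentiableAt ℝ G₀ x) (hH : DifferentiableAt ℝ H x) (hdt : HasFDerivAt t dt x)
    (ht : t x = 0) (hHs : ∀ v w : E, H x v w = H x w v) (X N : E) :
    2 * G₀ x (chrAt (perturb G₀ H t) x X X - chrAt G₀ x X X) N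
      = 2 * dt X * H x X N - dt N * H x X X := by
  rw [apply_chrAt_perturb_sub hx hG hH hdt ht, koszulVar, hHs N X]
  ring

/-! ### §2 The gauge 1-form `Υ₀(g, g⁰)` and its first variation -/

section Gauge

variable [FiniteDimensional ℝ E] {ι : Type*} [Fintype ι] (b : Basis ι ℝ E)

/-- **The generalized harmonic gauge 1-form `Υ₀(g, g⁰)` evaluated on `W`**, in a basis `b`:
`Υ₀(g,g⁰)(W) = Σ_{κλ} g^{κλ} g(Γ(g)(b_κ,b_λ) − Γ(g⁰)(b_κ,b_λ), W)` — Hintz's (4.x) `Eq1Ups0`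
(l.4163–4166: "`Υ₀(g,g⁰)_μ = g_{μν} g^{κλ}(Γ(g)^ν_{κλ} − Γ(g⁰)^ν_{κλ})`"; "`= tr_g(∇^g − ∇^{g⁰})`" in
Prop 5.25(2), l.5732) = HV18 Remark 2.1 `Υ(g)_μ = g_{μκ} g^{νλ}(Γ(g)^κ_{νλ} − Γ(t)^κ_{νλ})` with
background `t = g⁰`. The difference of two Christoffel maps is tensorial, so the value does not
depend on `b`; we keep `b` explicit as the tree's `gaugeFun` does.
[cite: Hintz2026, Def 4.1 / eq. (Eq1Ups0) TeX l.4154-4166 (transcription)] -/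
def upsilon0 (G Gb : E → E →L[ℝ] E →L[ℝ] ℝ) (x : E) (W : E) : ℝ :=
  ∑ i, ∑ j, ginv G b x i j * G x (chrAt G x (b i) (b j) - chrAt Gb x (b i) (b j)) W

/-- `Υ₀(g, g) = 0`. [folklore] -/
theorem upsilon0_self (G : E → E →L[ℝ] E →L[ℝ] ℝ) (x W : E) : upsilon0 b G G x W = 0 := by
  simp [upsilon0]

/-- **Link with the tree's wave-gauge functional**: `Υ₀(g,g⁰)(W) = Γ♭_g(W) − Σ g^{ij} g(Γ_{g⁰}(bᵢ,bⱼ), W)`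
(`MetricCoord.gaugeFun` = the lowered contracted Christoffel symbols); when the background's
Christoffel map vanishes at `x` (e.g. `g⁰` = Minkowski in standard coordinates) `Υ₀ = Γ♭`, "the
standard wave coordinate gauge" (Hintz l.4168). [cite: Hintz2026, text after eq. (Eq1Ups0) TeX l.4168] -/
theorem upsilon0_eq_gaugeFun_sub {G Gb : E → E →L[ℝ] E →L[ℝ] ℝ} {x : E}
    (hx : (G x).IsInvertible) (W : E) :
    upsilon0 b G Gb x W
      = gaugeFun b G x W - ∑ i, ∑ j, ginv G b x i j * G x (chrAt Gb x (b i) (b j)) W := by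
  rw [gaugeFun_eq b hx, upsilon0, ← Finset.sum_sub_distrib]
  refine Finset.sum_congr rfl fun i _ ↦ ?_
  rw [← Finset.sum_sub_distrib]
  refine Finset.sum_congr rfl fun j _ ↦ ?_
  rw [map_sub, sub_apply, mul_sub]

/-- `Υ₀ = Γ♭` when the background Christoffel map vanishes at the point. [folklore] -/
theorem upsilon0_eq_gaugeFun_of_chrAt_eq_zero {G Gb : E → E →L[ℝ] E →L[ℝ] ℝ} {x : E}
    (hx : (G x).IsInvertible) (hb : chrAt Gb x = 0) (W : E) :
    upsilon0 b G Gb x W = gaugeFun b G x W := by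
  rw [upsilon0_eq_gaugeFun_sub b hx, hb]
  simp

omit [Fintype ι] in
/-- Index-raised coefficients at `{t = 0}` are those of `g₀`. [folklore] -/
theorem ginv_perturb (ht : t x = 0) : ginv (perturb G₀ H t) b x = ginv G₀ b x := by
  funext i j
  simp only [ginv, sharpAt_perturb ht]

/-- **First variation of the gauge 1-form — the background cancels**: at `{t = 0}`,
`Υ₀(g₀ + t h̃, g_b)(W) − Υ₀(g₀, g_b)(W) = Σ_{ij} g₀^{ij} · ½ koszulVar dt h̃ (bᵢ) (bⱼ) W`, whatever the
background `g_b`. This is why the gauge condition `Υ₀(g, g_{b₀}) = 0` "reads" as Hintz's (5.x)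
`EqExIDGauge` (l.5753–5754): `tr_{g₀}(∇^{g₀+t h̃₁} − ∇^{g₀}) = −tr_{g₀}(∇^{g₀} − ∇^{g_{b₀}})`, and as
HV18's (3.x) `EqKdSInGaugeCond`: `(Υ(g_b) − Υ(g₀))(V) = (Υ(g₀+t_*g₁) − Υ(g₀))(V)`.
[cite: HintzVasy2018, Prop 3.10 (proof, eq. EqKdSInGaugeCond)] -/
theorem upsilon0_perturb_sub (hx : (G₀ x).IsInvertible) (hG : DifferentiableAt ℝ G₀ x)
    (hH : DifferentiableAt ℝ H x) (hdt : HasFDerivAt t dt x) (ht : t x = 0) (W : E) :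
    upsilon0 b (perturb G₀ H t) Gb x W - upsilon0 b G₀ Gb x W
      = ∑ i, ∑ j, ginv G₀ b x i j * (2⁻¹ * koszulVar dt (H x) (b i) (b j) W) := by
  unfold upsilon0
  rw [ginv_perturb b ht, perturb_eq_of_eq_zero ht, ← Finset.sum_sub_distrib]
  refine Finset.sum_congr rfl fun i _ ↦ ?_
  rw [← Finset.sum_sub_distrib]
  refine Finset.sum_congr rfl fun j _ ↦ ?_
  rw [← mul_sub, ← apply_chrAt_perturb_sub hx hG hH hdt ht]
  congr 1
  simp only [map_sub, sub_apply]
  ring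

/-- `β(♯α, W) = Σⱼ (Σᵢ g^{ji} α(bᵢ)) β(bⱼ, W)`: pairing a bilinear form with a raised covector,
in a basis. [folklore] -/
theorem apply_sharpAt_eq_sum {G : E → E →L[ℝ] E →L[ℝ] ℝ} {x : E}
    (β : E →L[ℝ] E →L[ℝ] ℝ) (α : E →L[ℝ] ℝ) (W : E) :
    β (sharpAt G x α) W = ∑ j, (∑ i, ginv G b x j i * α (b i)) * β (b j) W := by
  conv_lhs => rw [← b.sum_repr (sharpAt G x α)]
  rw [map_sum, _root_.sum_apply]
  refine Finset.sum_congr rfl fun j _ ↦ ?_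
  rw [map_smul, smul_apply, smul_eq_mul, ← Basis.coord_apply, coord_sharpAt_eq_sum]

/-- `β(W, ♯α) = Σⱼ (Σᵢ g^{ji} α(bᵢ)) β(W, bⱼ)`. [folklore] -/
theorem apply_apply_sharpAt_eq_sum {G : E → E →L[ℝ] E →L[ℝ] ℝ} {x : E}
    (β : E →L[ℝ] E →L[ℝ] ℝ) (α : E →L[ℝ] ℝ) (W : E) :
    β W (sharpAt G x α) = ∑ j, (∑ i, ginv G b x j i * α (b i)) * β W (b j) := by
  conv_lhs => rw [← b.sum_repr (sharpAt G x α)]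
  rw [map_sum]
  refine Finset.sum_congr rfl fun j _ ↦ ?_
  rw [map_smul, smul_eq_mul, ← Basis.coord_apply, coord_sharpAt_eq_sum]

/-- **The trace reversal** `𝖦_g h = h − ½ (tr_g h) g` at the point `x` (Hintz l.4159
"`\sfG_g h := h − ½ g tr_g h`"; HV18 §2.1 `G_g r = r − ½(tr_g r) g`).
[cite: Hintz2026, Def 4.1 TeX l.4159 (transcription)] -/
def traceRev (G : E → E →L[ℝ] E →L[ℝ] ℝ) (x : E) (h : E →L[ℝ] E →L[ℝ] ℝ) : E →L[ℝ] E →L[ℝ] ℝ :=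
  h - (2⁻¹ * mtrAt G x h) • G x

omit [FiniteDimensional ℝ E] in
/-- Unfolding lemma for `traceRev`. [folklore] -/
@[simp]
theorem traceRev_apply (G : E → E →L[ℝ] E →L[ℝ] ℝ) (x : E) (h : E →L[ℝ] E →L[ℝ] ℝ) (v w : E) :
    traceRev G x h v w = h v w - 2⁻¹ * mtrAt G x h * G x v w := by
  simp [traceRev, smul_eq_mul, mul_assoc]

/-- **The basis sum IS HV18's trace-reversal form**: for symmetric `g₀(x)` and `h̃(x)`,
`Σ_{ij} g₀^{ij} · ½ koszulVar dt h̃ bᵢ bⱼ W = h̃(∇t, W) − ½ (W t) tr_{g₀} h̃`, `∇t = ♯dt` —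
HV18 (3.x) `EqKdSInGaugeCond`: "`= g₁(∇^{g₀}t_*, V) − ½(V t_*) tr_{g₀} g₁ = (G_{g₀} g₁)(∇^{g₀}t_*, V)`".
[cite: HintzVasy2018, Prop 3.10 (proof, eq. EqKdSInGaugeCond)] -/
theorem sum_ginv_koszulVar_eq (hx : (G₀ x).IsInvertible) (hGs : ∀ v w : E, G₀ x v w = G₀ x w v)
    (hHs : ∀ v w : E, H x v w = H x w v) (W : E) :
    ∑ i, ∑ j, ginv G₀ b x i j * (2⁻¹ * koszulVar dt (H x) (b i) (b j) W)
      = H x (sharpAt G₀ x dt) W - 2⁻¹ * dt W * mtrAt G₀ x (H x) := by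
  have hA : ∑ i, ∑ j, ginv G₀ b x i j * (dt (b i) * H x (b j) W)
      = H x (sharpAt G₀ x dt) W := by
    rw [apply_sharpAt_eq_sum b, Finset.sum_comm]
    refine Finset.sum_congr rfl fun j _ ↦ ?_
    rw [Finset.sum_mul]
    refine Finset.sum_congr rfl fun i _ ↦ ?_
    rw [ginv_comm b hx hGs i j]
    ring
  have hB : ∑ i, ∑ j, ginv G₀ b x i j * (dt (b j) * H x W (b i))
      = H x (sharpAt G₀ x dt) W := by
    rw [hHs, apply_apply_sharpAt_eq_sum b]
    refine Finset.sum_congr rfl fun i _ ↦ ?_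
    rw [Finset.sum_mul]
    refine Finset.sum_congr rfl fun j _ ↦ ?_
    ring
  have hC : ∑ i, ∑ j, ginv G₀ b x i j * H x (b i) (b j) = mtrAt G₀ x (H x) :=
    (mtrAt_eq_sum b (H x)).symm
  have hsplit : ∀ i j, ginv G₀ b x i j * (2⁻¹ * koszulVar dt (H x) (b i) (b j) W)
      = 2⁻¹ * (ginv G₀ b x i j * (dt (b i) * H x (b j) W))
        + 2⁻¹ * (ginv G₀ b x i j * (dt (b j) * H x W (b i)))
        - 2⁻¹ * dt W * (ginv G₀ b x i j * H x (b i) (b j)) := by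
    intro i j
    rw [koszulVar]
    ring
  simp_rw [hsplit, Finset.sum_sub_distrib, Finset.sum_add_distrib, ← Finset.mul_sum, hA, hB, hC]
  ring

/-- The same, packaged: the variation of `Υ₀` is the trace-reversed `h̃` evaluated on `(∇t, W)`,
`g₀(∇t, W) = dt(W)`. [cite: HintzVasy2018, Prop 3.10 (proof, eq. EqKdSInGaugeCond)] -/
theorem upsilon0_perturb_sub_eq_traceRev (hx : (G₀ x).IsInvertible)
    (hGs : ∀ v w : E, G₀ x v w = G₀ x w v) (hHs : ∀ v w : E, H x v w = H x w v)
    (hG : DifferentiableAt ℝ G₀ x) (hH : DifferentiableAt ℝ H x) (hdt : HasFDerivAt t dt x)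
    (ht : t x = 0) (W : E) :
    upsilon0 b (perturb G₀ H t) Gb x W - upsilon0 b G₀ Gb x W
      = traceRev G₀ x (H x) (sharpAt G₀ x dt) W := by
  rw [upsilon0_perturb_sub b hx hG hH hdt ht, sum_ginv_koszulVar_eq b hx hGs hHs,
    traceRev_apply, apply_sharpAt_apply hx]
  ring

end Gauge

/-! ### §3 The adapted frame and the triangular determination of `h̃₁` (matrix level) -/

section Frame

variable {n : ℕ}

/-- The frame components `t_{;μ} = e_μ t` of `dt` in an ADAPTED frame `e₀, e₁, …, e_n`
(`e₀` transversal to `Σ = {t = 0}`, `e₁, …, e_n` tangent to `Σ`): `(τ, 0, …, 0)` — Hintz l.5758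
"`e₀ t_IVP > 0` … while `e_i t_IVP = 0` for `i = 1,2,3`"; HV24 "`τ_{;μ} = 0` unless `μ = 0`". Index `0`
is the normal slot, `Fin.succ i` the tangential ones. [cite: Hintz2026, Prop 5.25 proof TeX l.5758 (transcription)] -/
def tcomp (τ : ℝ) : Fin (n + 1) → ℝ := Fin.cases τ (fun _ ↦ 0)

/-- `t_{;0} = τ`. [folklore] -/
@[simp] theorem tcomp_zero (τ : ℝ) : tcomp (n := n) τ 0 = τ := by simp [tcomp]

/-- `t_{;i} = 0` for tangential `i`. [folklore] -/
@[simp] theorem tcomp_succ (τ : ℝ) (i : Fin n) : tcomp τ i.succ = 0 := by simp [tcomp]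

/-- `Σ_μ t_{;μ} f(μ) = τ f(0)` in an adapted frame. [folklore] -/
theorem sum_tcomp_mul (τ : ℝ) (f : Fin (n + 1) → ℝ) : ∑ μ, tcomp τ μ * f μ = τ * f 0 := by
  rw [Fin.sum_univ_succ]; simp

/-- **The variation of the Christoffel symbols of the first kind in frame components**:
`kosVar t h λ μ ν = ½ (t_μ h_{νλ} + t_ν h_{λμ} − t_λ h_{μν}) = Γ(g₀ + t h̃)_{λμν} − Γ(g₀)_{λμν}`
(Hintz l.5760, halved; `= ½ koszulVar dt h̃ e_μ e_ν e_λ`, see `kosVar_frame`).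
[cite: Hintz2026, Prop 5.25 proof TeX l.5760 (transcription)] -/
def kosVar (t : Fin (n + 1) → ℝ) (h : Fin (n + 1) → Fin (n + 1) → ℝ) (l μ ν : Fin (n + 1)) : ℝ :=
  2⁻¹ * (t μ * h ν l + t ν * h l μ - t l * h μ ν)

/-- **Second-fundamental-form components of the variation**: the left-hand side of Hintz's
(5.x) `EqExIDk` at `(X,Y) = (e_i, e_j)`, `g₀((∇¹_{e_i} − ∇⁰_{e_i})e_j, e₀) = δΓ_{0ij}`.
[cite: Hintz2026, Prop 5.25 proof TeX l.5749, l.5762 (transcription)] -/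
def sffVar (t : Fin (n + 1) → ℝ) (h : Fin (n + 1) → Fin (n + 1) → ℝ) (i j : Fin n) : ℝ :=
  kosVar t h 0 i.succ j.succ

/-- **Gauge components of the variation**: the `e^λ`-component of `tr_{g₀}(∇¹ − ∇⁰)`,
`Σ_{μν} g^{μν} δΓ_{λμν}` (Hintz (5.x) `EqExIDGauge` / display l.5763–5764; `g` = the inverse-metric
coefficients `(g₀)^{μν}` in the frame). [cite: Hintz2026, Prop 5.25 proof TeX l.5753-5764 (transcription)] -/
def gaugeVar (g : Fin (n + 1) → Fin (n + 1) → ℝ) (t : Fin (n + 1) → ℝ)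
    (h : Fin (n + 1) → Fin (n + 1) → ℝ) (l : Fin (n + 1)) : ℝ :=
  ∑ μ, ∑ ν, g μ ν * kosVar t h l μ ν

/-- **"equals `−½(e₀ t_IVP)(h̃₁)_{ij}`"** (Hintz l.5762): in an adapted frame the
second-fundamental-form components of the variation are `−½ τ h_{ij}` — no symmetry needed.
[cite: Hintz2026, Prop 5.25 proof TeX l.5762 (claim under review; here proved)] -/
theorem sffVar_tcomp (τ : ℝ) (h : Fin (n + 1) → Fin (n + 1) → ℝ) (i j : Fin n) :
    sffVar (tcomp τ) h i j = -(2⁻¹ * τ * h i.succ j.succ) := by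
  simp [sffVar, kosVar]
  ring

/-- **The printed gauge components** (Hintz l.5763–5764): in an adapted frame, for symmetric `g`, `h`,
`Σ g^{μν} δΓ_{λμν} = (g⁰)^{0μ}(e₀ t)(h̃₁)_{μλ} − ½ (e_λ t)(g⁰)^{μν}(h̃₁)_{μν}`.
[cite: Hintz2026, Prop 5.25 proof TeX l.5763-5764 (claim under review; here proved)] -/
theorem gaugeVar_tcomp (g : Fin (n + 1) → Fin (n + 1) → ℝ) (τ : ℝ)
    (h : Fin (n + 1) → Fin (n + 1) → ℝ) (hg : ∀ μ ν, g μ ν = g ν μ) (hh : ∀ μ ν, h μ ν = h ν μ)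
    (l : Fin (n + 1)) :
    gaugeVar g (tcomp τ) h l
      = τ * (∑ μ, g 0 μ * h μ l) - 2⁻¹ * tcomp τ l * ∑ μ, ∑ ν, g μ ν * h μ ν := by
  have hsplit : ∀ μ ν, g μ ν * kosVar (tcomp τ) h l μ ν
      = 2⁻¹ * (tcomp τ μ * (g μ ν * h ν l)) + 2⁻¹ * (tcomp τ ν * (g ν μ * h μ l))
        - 2⁻¹ * tcomp τ l * (g μ ν * h μ ν) := by
    intro μ ν; rw [kosVar, hg ν μ, hh l μ]; ring
  unfold gaugeVar
  simp_rw [hsplit, Finset.sum_sub_distrib, Finset.sum_add_distrib, ← Finset.mul_sum,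
    sum_tcomp_mul]
  simp_rw [← Finset.mul_sum]
  ring

/-- Tangential gauge components: for `λ = j` tangential the trace term drops,
`Σ g^{μν} δΓ_{jμν} = τ Σ_μ g^{0μ} h_{μj}` ("For `λ = j = 1,2,3`, this uniquely determines `(h̃₁)_{0j}`",
l.5766: given the tangential block, the unknown `h_{0j}` enters with coefficient `τ g^{00}`).
[cite: Hintz2026, Prop 5.25 proof TeX l.5766 (claim under review; here proved)] -/
theorem gaugeVar_tcomp_succ (g : Fin (n + 1) → Fin (n + 1) → ℝ) (τ : ℝ)
    (h : Fin (n + 1) → Fin (n + 1) → ℝ) (hg : ∀ μ ν, g μ ν = g ν μ) (hh : ∀ μ ν, h μ ν = h ν μ)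
    (j : Fin n) :
    gaugeVar g (tcomp τ) h j.succ
      = τ * (g 0 0 * h 0 j.succ + ∑ i : Fin n, g 0 i.succ * h i.succ j.succ) := by
  rw [gaugeVar_tcomp g τ h hg hh, tcomp_succ, Fin.sum_univ_succ]
  ring

/-- Normal gauge component: for `λ = 0` the cross terms `g^{0i}` CANCEL and
`Σ g^{μν} δΓ_{0μν} = ½ τ g^{00} h_{00} − ½ τ Σ_{ij} g^{ij} h_{ij}` (tangential `i,j`) — so `h_{00}` is
determined by the tangential block alone ("and for `λ = 0` one obtains …, which thus determines
`(h̃₁)_{00}`", l.5766). [cite: Hintz2026, Prop 5.25 proof TeX l.5766 (claim under review; here proved)] -/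
theorem gaugeVar_tcomp_zero (g : Fin (n + 1) → Fin (n + 1) → ℝ) (τ : ℝ)
    (h : Fin (n + 1) → Fin (n + 1) → ℝ) (hg : ∀ μ ν, g μ ν = g ν μ) (hh : ∀ μ ν, h μ ν = h ν μ) :
    gaugeVar g (tcomp τ) h 0
      = 2⁻¹ * τ * g 0 0 * h 0 0
        - 2⁻¹ * τ * ∑ i : Fin n, ∑ j : Fin n, g i.succ j.succ * h i.succ j.succ := by
  rw [gaugeVar_tcomp g τ h hg hh, tcomp_zero, Fin.sum_univ_succ, Fin.sum_univ_succ,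
    Fin.sum_univ_succ]
  simp_rw [Fin.sum_univ_succ (f := fun ν ↦ g (Fin.succ _) ν * h (Fin.succ _) ν),
    Finset.sum_add_distrib]
  have h1 : ∑ i : Fin n, g i.succ 0 * h i.succ 0 = ∑ i : Fin n, g 0 i.succ * h i.succ 0 := by
    refine Finset.sum_congr rfl fun i _ ↦ ?_; rw [hg]
  have h2 : ∑ i : Fin n, g 0 i.succ * h 0 i.succ = ∑ i : Fin n, g 0 i.succ * h i.succ 0 := by
    refine Finset.sum_congr rfl fun i _ ↦ ?_; rw [hh]
  rw [h1, h2]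
  ring

/-- **The printed normalisation** `e₀ = ν` unit timelike normal, `e_i ⊥ e₀`: `g^{00} = −1`, `g^{0i} = 0`.
Then the normal gauge component is `−½ (e₀ t) h̃_{00} − ½ (e₀ t) (g⁰)^{ij} h̃_{ij}` — Hintz's last
sentence of the proof (l.5766) verbatim: "`−½(e₀ t_IVP)(h̃₁)_{00} = f₀ + ½(e₀ t_IVP)(g⁰)^{ij}(h̃₁)_{ij}`".
[cite: Hintz2026, Prop 5.25 proof TeX l.5766 (claim under review; here proved)] -/
theorem gaugeVar_tcomp_zero_unitNormal (g : Fin (n + 1) → Fin (n + 1) → ℝ) (τ : ℝ)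
    (h : Fin (n + 1) → Fin (n + 1) → ℝ) (hg : ∀ μ ν, g μ ν = g ν μ) (hh : ∀ μ ν, h μ ν = h ν μ)
    (h00 : g 0 0 = -1) :
    gaugeVar g (tcomp τ) h 0
      = -(2⁻¹ * τ * h 0 0)
        - 2⁻¹ * τ * ∑ i : Fin n, ∑ j : Fin n, g i.succ j.succ * h i.succ j.succ := by
  rw [gaugeVar_tcomp_zero g τ h hg hh, h00]; ring

/-- And the tangential ones: `−(e₀ t) h̃_{0j} = f_j`. [cite: Hintz2026, Prop 5.25 proof TeX l.5766 (claim under review; here proved)] -/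
theorem gaugeVar_tcomp_succ_unitNormal (g : Fin (n + 1) → Fin (n + 1) → ℝ) (τ : ℝ)
    (h : Fin (n + 1) → Fin (n + 1) → ℝ) (hg : ∀ μ ν, g μ ν = g ν μ) (hh : ∀ μ ν, h μ ν = h ν μ)
    (h00 : g 0 0 = -1) (h0i : ∀ i : Fin n, g 0 i.succ = 0) (j : Fin n) :
    gaugeVar g (tcomp τ) h j.succ = -(τ * h 0 j.succ) := by
  rw [gaugeVar_tcomp_succ g τ h hg hh, h00]
  simp [h0i]

/-! #### The explicit triangular solution and its uniqueness -/

/-- Tangential block of the solution: `h_{ij} = −2 κ_{ij} / τ` (from `−½ τ h_{ij} = κ_{ij}`).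
[cite: Hintz2026, Prop 5.25 proof TeX l.5762 (transcription of "uniquely determines (h̃₁)_{ij}")] -/
def solveTT (τ : ℝ) (κ : Fin n → Fin n → ℝ) (i j : Fin n) : ℝ := -(2 * κ i j) / τ

/-- Mixed components: `h_{0j} = (f_j / τ − Σ_i g^{0i} h_{ij}) / g^{00}`.
[cite: Hintz2026, Prop 5.25 proof TeX l.5766 (transcription of "uniquely determines (h̃₁)_{0j}")] -/
def solveNT (g : Fin (n + 1) → Fin (n + 1) → ℝ) (τ : ℝ) (κ : Fin n → Fin n → ℝ)
    (f : Fin (n + 1) → ℝ) (j : Fin n) : ℝ :=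
  (f j.succ / τ - ∑ i : Fin n, g 0 i.succ * solveTT τ κ i j) / g 0 0

/-- Normal component: `h_{00} = (2 f₀ / τ + Σ_{ij} g^{ij} h_{ij}) / g^{00}`.
[cite: Hintz2026, Prop 5.25 proof TeX l.5766 (transcription of "determines (h̃₁)_{00}")] -/
def solveNN (g : Fin (n + 1) → Fin (n + 1) → ℝ) (τ : ℝ) (κ : Fin n → Fin n → ℝ)
    (f : Fin (n + 1) → ℝ) : ℝ :=
  (2 * f 0 / τ + ∑ i : Fin n, ∑ j : Fin n, g i.succ j.succ * solveTT τ κ i j) / g 0 0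

/-- **The solution `h̃₁` of the `½(n+1)(n+2) = ½n(n+1) + (n+1)` linear conditions** (prescribed
second-fundamental-form components `κ` and gauge components `f`), assembled from its three blocks.
[cite: Hintz2026, Prop 5.25 proof TeX l.5758-5766 (transcription)] -/
def solve (g : Fin (n + 1) → Fin (n + 1) → ℝ) (τ : ℝ) (κ : Fin n → Fin n → ℝ)
    (f : Fin (n + 1) → ℝ) : Fin (n + 1) → Fin (n + 1) → ℝ :=
  Fin.cases (Fin.cases (solveNN g τ κ f) (solveNT g τ κ f))
    (fun i ↦ Fin.cases (solveNT g τ κ f i) (solveTT τ κ i))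

variable (g : Fin (n + 1) → Fin (n + 1) → ℝ) (τ : ℝ) (κ : Fin n → Fin n → ℝ) (f : Fin (n + 1) → ℝ)

/-- Unfolding lemma. [folklore] -/
@[simp] theorem solve_zero_zero : solve g τ κ f 0 0 = solveNN g τ κ f := by simp [solve]
/-- Unfolding lemma. [folklore] -/
@[simp] theorem solve_zero_succ (j : Fin n) : solve g τ κ f 0 j.succ = solveNT g τ κ f j := by
  simp [solve]
/-- Unfolding lemma. [folklore] -/
@[simp] theorem solve_succ_zero (i : Fin n) : solve g τ κ f i.succ 0 = solveNT g τ κ f i := by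
  simp [solve]
/-- Unfolding lemma. [folklore] -/
@[simp] theorem solve_succ_succ (i j : Fin n) : solve g τ κ f i.succ j.succ = solveTT τ κ i j := by
  simp [solve]

variable {g τ κ f}

/-- The solution is symmetric when `κ` is. [folklore] -/
theorem solve_symm (hκ : ∀ i j, κ i j = κ j i) (μ ν : Fin (n + 1)) :
    solve g τ κ f μ ν = solve g τ κ f ν μ := by
  induction μ using Fin.cases with
  | zero => induction ν using Fin.cases with
    | zero => rfl
    | succ j => simp
  | succ i => induction ν using Fin.cases with
    | zero => simp
    | succ j => simp [solveTT, hκ i j]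

/-- **Existence, tangential conditions**: `sffVar (tcomp τ) (solve …) = κ`. [folklore] -/
theorem sffVar_solve (hτ : τ ≠ 0) (i j : Fin n) : sffVar (tcomp τ) (solve g τ κ f) i j = κ i j := by
  rw [sffVar_tcomp, solve_succ_succ, solveTT]
  field_simp

/-- **Existence, gauge conditions**: `gaugeVar g (tcomp τ) (solve …) = f` (needs `τ ≠ 0`,
`g^{00} ≠ 0`, `g` and `κ` symmetric). [folklore] -/
theorem gaugeVar_solve (hτ : τ ≠ 0) (hg00 : g 0 0 ≠ 0) (hg : ∀ μ ν, g μ ν = g ν μ)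
    (hκ : ∀ i j, κ i j = κ j i) (l : Fin (n + 1)) :
    gaugeVar g (tcomp τ) (solve g τ κ f) l = f l := by
  have hs : ∀ μ ν, solve g τ κ f μ ν = solve g τ κ f ν μ := solve_symm hκ
  induction l using Fin.cases with
  | zero =>
    rw [gaugeVar_tcomp_zero g τ _ hg hs, solve_zero_zero, solveNN]
    simp only [solve_succ_succ]
    field_simp
    ring
  | succ j =>
    rw [gaugeVar_tcomp_succ g τ _ hg hs, solve_zero_succ, solveNT]
    simp only [solve_succ_succ]
    field_simp
    ring

/-- **Uniqueness** ("uniquely determines", l.5762/l.5766, three times): two symmetric `h`, `h'`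
with the same second-fundamental-form components and the same gauge components in an adapted frame
with `τ ≠ 0` and `g^{00} ≠ 0` are equal — read off in the printed order `(ij) → (0j) → (00)`.
[cite: Hintz2026, Prop 5.25 proof TeX l.5758-5766 (claim under review; here proved)] -/
theorem eq_of_sffVar_eq_of_gaugeVar_eq (hτ : τ ≠ 0) (hg00 : g 0 0 ≠ 0) (hg : ∀ μ ν, g μ ν = g ν μ)
    {h h' : Fin (n + 1) → Fin (n + 1) → ℝ} (hh : ∀ μ ν, h μ ν = h ν μ) (hh' : ∀ μ ν, h' μ ν = h' ν μ)
    (hK : ∀ i j, sffVar (tcomp τ) h i j = sffVar (tcomp τ) h' i j)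
    (hY : ∀ l, gaugeVar g (tcomp τ) h l = gaugeVar g (tcomp τ) h' l) : h = h' := by
  -- tangential block
  have hTT : ∀ i j : Fin n, h i.succ j.succ = h' i.succ j.succ := by
    intro i j
    have := hK i j
    rw [sffVar_tcomp, sffVar_tcomp] at this
    have h2 : (2⁻¹ * τ) * h i.succ j.succ = (2⁻¹ * τ) * h' i.succ j.succ := by linarith
    exact mul_left_cancel₀ (by positivity) h2
  -- mixed block
  have hNT : ∀ j : Fin n, h 0 j.succ = h' 0 j.succ := by
    intro j
    have := hY j.succ
    rw [gaugeVar_tcomp_succ g τ h hg hh, gaugeVar_tcomp_succ g τ h' hg hh'] at this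
    simp_rw [hTT] at this
    have h2 : τ * (g 0 0 * h 0 j.succ) = τ * (g 0 0 * h' 0 j.succ) := by linarith
    exact mul_left_cancel₀ hg00 (mul_left_cancel₀ hτ h2)
  -- normal component
  have hNN : h 0 0 = h' 0 0 := by
    have := hY 0
    rw [gaugeVar_tcomp_zero g τ h hg hh, gaugeVar_tcomp_zero g τ h' hg hh'] at this
    simp_rw [hTT] at this
    have h2 : (2⁻¹ * τ * g 0 0) * h 0 0 = (2⁻¹ * τ * g 0 0) * h' 0 0 := by linarith
    have hne : 2⁻¹ * τ * g 0 0 ≠ 0 := by positivity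
    exact mul_left_cancel₀ hne h2
  funext μ ν
  induction μ using Fin.cases with
  | zero => induction ν using Fin.cases with
    | zero => exact hNN
    | succ j => exact hNT j
  | succ i => induction ν using Fin.cases with
    | zero => rw [hh, hh', hNT i]
    | succ j => exact hTT i j

/-- **Prop 5.25's algebra in one statement**: in an adapted frame (`e₀ t = τ ≠ 0`, `e_i t = 0`,
`g^{00} ≠ 0`, `g^{μν}` symmetric) and for symmetric prescribed second-fundamental-form components `κ`
and arbitrary prescribed gauge components `f`, there is EXACTLY ONE symmetric `h̃₁` producing them —
the content of "thus uniquely determines `(h̃₁)_{ij}` … `(h̃₁)_{0j}` … `(h̃₁)_{00}`" (Hintz l.5762–5766)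
and of HV18 Prop 3.10's "the symmetric 2-tensor `g₁` … is determined uniquely once we fix the values of
`g₁(N,N)` and `g₁(X,N)` … These values in turn are determined by the gauge condition" (the two texts
eliminate in different orders; the statement is order-free). Any spatial dimension `n`; print `n = 3`.
[cite: HintzVasy2018, Prop 3.10 (proof)] -/
theorem existsUnique_solution (hτ : τ ≠ 0) (hg00 : g 0 0 ≠ 0) (hg : ∀ μ ν, g μ ν = g ν μ)
    (hκ : ∀ i j, κ i j = κ j i) :
    ∃! h : Fin (n + 1) → Fin (n + 1) → ℝ,
      (∀ μ ν, h μ ν = h ν μ) ∧ (∀ i j, sffVar (tcomp τ) h i j = κ i j)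
        ∧ (∀ l, gaugeVar g (tcomp τ) h l = f l) := by
  refine ⟨solve g τ κ f, ⟨solve_symm hκ, sffVar_solve hτ, gaugeVar_solve hτ hg00 hg hκ⟩, ?_⟩
  rintro h ⟨hh, hK, hY⟩
  refine eq_of_sffVar_eq_of_gaugeVar_eq hτ hg00 hg hh (solve_symm hκ) (fun i j ↦ ?_) (fun l ↦ ?_)
  · rw [hK, sffVar_solve hτ]
  · rw [hY, gaugeVar_solve hτ hg00 hg hκ]

/-- **Zero data give zero `h̃₁`** ("equal to `0` when `(γ̃, k̃) = (0,0)`", l.5729: then both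
right-hand sides (EqExIDk), (EqExIDGauge) vanish). [cite: Hintz2026, Prop 5.25 TeX l.5729 (claim under review; algebraic half proved)] -/
theorem solve_zero_data : solve g τ (0 : Fin n → Fin n → ℝ) (0 : Fin (n + 1) → ℝ) = 0 := by
  funext μ ν
  induction μ using Fin.cases with
  | zero => induction ν using Fin.cases with
    | zero => simp [solveNN, solveTT]
    | succ j => simp [solveNT, solveTT]
  | succ i => induction ν using Fin.cases with
    | zero => simp [solveNT, solveTT]
    | succ j => simp [solveTT]

/-- `kosVar` is additive in `h`. [folklore] -/
theorem kosVar_add (t : Fin (n + 1) → ℝ) (h h' : Fin (n + 1) → Fin (n + 1) → ℝ) (l μ ν : Fin (n + 1)) :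
    kosVar t (h + h') l μ ν = kosVar t h l μ ν + kosVar t h' l μ ν := by
  simp [kosVar]; ring

/-- `kosVar` is homogeneous in `h`. [folklore] -/
theorem kosVar_smul (t : Fin (n + 1) → ℝ) (c : ℝ) (h : Fin (n + 1) → Fin (n + 1) → ℝ)
    (l μ ν : Fin (n + 1)) : kosVar t (c • h) l μ ν = c * kosVar t h l μ ν := by
  simp [kosVar]; ring

/-- `sffVar` is additive in `h`. [folklore] -/
theorem sffVar_add (t : Fin (n + 1) → ℝ) (h h' : Fin (n + 1) → Fin (n + 1) → ℝ) (i j : Fin n) :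
    sffVar t (h + h') i j = sffVar t h i j + sffVar t h' i j := kosVar_add t h h' _ _ _

/-- `gaugeVar` is additive in `h`. [folklore] -/
theorem gaugeVar_add (g : Fin (n + 1) → Fin (n + 1) → ℝ) (t : Fin (n + 1) → ℝ)
    (h h' : Fin (n + 1) → Fin (n + 1) → ℝ) (l : Fin (n + 1)) :
    gaugeVar g t (h + h') l = gaugeVar g t h l + gaugeVar g t h' l := by
  simp only [gaugeVar, kosVar_add, mul_add, Finset.sum_add_distrib]

/-- **Linearity of the solution map in the data** `(κ, f)` (the algebraic half of "depending
continuously on `γ̃` and `k̃`", l.5729: `h̃₁` is obtained from the two right-hand sides by a linear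
map — here from uniqueness). [cite: Hintz2026, Prop 5.25 TeX l.5729 (claim under review; algebraic half proved)] -/
theorem solve_add (hτ : τ ≠ 0) (hg00 : g 0 0 ≠ 0) (hg : ∀ μ ν, g μ ν = g ν μ)
    {κ κ' : Fin n → Fin n → ℝ} (hκ : ∀ i j, κ i j = κ j i) (hκ' : ∀ i j, κ' i j = κ' j i)
    (f f' : Fin (n + 1) → ℝ) :
    solve g τ (κ + κ') (f + f') = solve g τ κ f + solve g τ κ' f' := by
  have hsum : ∀ i j, (κ + κ') i j = (κ + κ') j i := fun i j ↦ by
    simp only [Pi.add_apply, hκ i j, hκ' i j]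
  obtain ⟨h₀, -, huniq⟩ := existsUnique_solution (f := f + f') hτ hg00 hg hsum
  have e1 := huniq _ ⟨solve_symm hsum, sffVar_solve hτ, gaugeVar_solve hτ hg00 hg hsum⟩
  have e2 : solve g τ κ f + solve g τ κ' f' = h₀ := by
    refine huniq _ ⟨fun μ ν ↦ ?_, fun i j ↦ ?_, fun l ↦ ?_⟩
    · simp only [Pi.add_apply, solve_symm hκ μ ν, solve_symm hκ' μ ν]
    · rw [sffVar_add, sffVar_solve hτ, sffVar_solve hτ, Pi.add_apply, Pi.add_apply]
    · rw [gaugeVar_add, gaugeVar_solve hτ hg00 hg hκ, gaugeVar_solve hτ hg00 hg hκ', Pi.add_apply]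
  rw [e1, e2]

end Frame

/-! ### §3b From the tensor identities to the frame components; the unit-normal frame -/

section Bridge

variable [FiniteDimensional ℝ E] {n : ℕ} (b : Basis (Fin (n + 1)) ℝ E)

/-- Frame components `h_{μν} = h̃(e_μ, e_ν)` of a field of bilinear forms at `x`. [folklore] -/
def hcomp (H : E → E →L[ℝ] E →L[ℝ] ℝ) (x : E) (μ ν : Fin (n + 1)) : ℝ := H x (b μ) (b ν)

omit [FiniteDimensional ℝ E] in
/-- Unfolding lemma for `hcomp`. [folklore] -/
@[simp] theorem hcomp_apply (H : E → E →L[ℝ] E →L[ℝ] ℝ) (x : E) (μ ν : Fin (n + 1)) :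
    hcomp b H x μ ν = H x (b μ) (b ν) := rfl

variable {G₀ H Gb : E → E →L[ℝ] E →L[ℝ] ℝ} {t : E → ℝ} {x : E} {dt : E →L[ℝ] ℝ} {τ : ℝ}

omit [FiniteDimensional ℝ E] in
/-- The tensor variation on frame vectors IS the componentwise `kosVar`:
`½ koszulVar dt h̃ e_μ e_ν e_λ = kosVar (e_· t) (h̃(e_·,e_·)) λ μ ν`. [folklore] -/
theorem kosVar_frame (μ ν l : Fin (n + 1)) :
    2⁻¹ * koszulVar dt (H x) (b μ) (b ν) (b l) = kosVar (fun κ ↦ dt (b κ)) (hcomp b H x) l μ ν := by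
  simp [koszulVar, kosVar]

omit [FiniteDimensional ℝ E] in
/-- An ADAPTED frame (`e₀ t = τ`, `e_i t = 0`) has `dt`-components `tcomp τ`. [folklore] -/
theorem frame_tcomp (h0 : dt (b 0) = τ) (htan : ∀ i : Fin n, dt (b i.succ) = 0) :
    (fun κ ↦ dt (b κ)) = tcomp τ := by
  funext κ
  induction κ using Fin.cases with
  | zero => simp [h0]
  | succ i => simp [htan i]

omit [FiniteDimensional ℝ E] in
/-- **(EqExIDk)'s left-hand side at `(e_i, e_j)` is `sffVar`** — the tensor identity of §1 read in an
adapted frame whose `e₀` is the vector paired against (`ν = e₀`). [cite: Hintz2026, Prop 5.25 proof TeX l.5749, l.5758-5762 (claim under review; here proved)] -/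
theorem apply_chrAt_perturb_sub_frame (hx : (G₀ x).IsInvertible) (hG : DifferentiableAt ℝ G₀ x)
    (hH : DifferentiableAt ℝ H x) (hdt : HasFDerivAt t dt x) (ht : t x = 0)
    (h0 : dt (b 0) = τ) (htan : ∀ i : Fin n, dt (b i.succ) = 0) (i j : Fin n) :
    G₀ x (chrAt (perturb G₀ H t) x (b i.succ) (b j.succ) - chrAt G₀ x (b i.succ) (b j.succ)) (b 0)
      = sffVar (tcomp τ) (hcomp b H x) i j := by
  rw [apply_chrAt_perturb_sub hx hG hH hdt ht, kosVar_frame b, frame_tcomp b h0 htan, sffVar]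

/-- **(EqExIDGauge)'s left-hand side on `e_λ` is `gaugeVar`** with `g = (g₀^{μν})` the tree's `ginv`.
[cite: Hintz2026, Prop 5.25 proof TeX l.5753-5764 (claim under review; here proved)] -/
theorem upsilon0_perturb_sub_frame (hx : (G₀ x).IsInvertible) (hG : DifferentiableAt ℝ G₀ x)
    (hH : DifferentiableAt ℝ H x) (hdt : HasFDerivAt t dt x) (ht : t x = 0)
    (h0 : dt (b 0) = τ) (htan : ∀ i : Fin n, dt (b i.succ) = 0) (l : Fin (n + 1)) :
    upsilon0 b (perturb G₀ H t) Gb x (b l) - upsilon0 b G₀ Gb x (b l)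
      = gaugeVar (ginv G₀ b x) (tcomp τ) (hcomp b H x) l := by
  rw [upsilon0_perturb_sub b hx hG hH hdt ht, gaugeVar]
  simp_rw [kosVar_frame b, frame_tcomp b h0 htan]

/-- **Prop 5.25's pointwise algebra, tensor level**: in an adapted frame at a point of `{t = 0}` with
`e₀ t = τ ≠ 0`, `g₀^{00} ≠ 0`, the symmetric `h̃₁(x)` with prescribed second-fundamental-form variation
`κ` on `TΣ × TΣ` (against `e₀`) and prescribed gauge variation `f` is unique, and its frame components
are `solve (g₀^{μν}) τ κ f`. [cite: HintzVasy2018, Prop 3.10 (proof); Hintz2026 Prop 5.25 proof TeX l.5758-5766] -/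
theorem hcomp_eq_solve (hx : (G₀ x).IsInvertible) (hGs : ∀ v w : E, G₀ x v w = G₀ x w v)
    (hHs : ∀ v w : E, H x v w = H x w v) (hG : DifferentiableAt ℝ G₀ x)
    (hH : DifferentiableAt ℝ H x) (hdt : HasFDerivAt t dt x) (ht : t x = 0)
    (h0 : dt (b 0) = τ) (htan : ∀ i : Fin n, dt (b i.succ) = 0) (hτ : τ ≠ 0)
    (hg00 : ginv G₀ b x 0 0 ≠ 0) {κ : Fin n → Fin n → ℝ} (hκ : ∀ i j, κ i j = κ j i)
    {f : Fin (n + 1) → ℝ}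
    (hK : ∀ i j : Fin n, G₀ x (chrAt (perturb G₀ H t) x (b i.succ) (b j.succ)
        - chrAt G₀ x (b i.succ) (b j.succ)) (b 0) = κ i j)
    (hY : ∀ l : Fin (n + 1), upsilon0 b (perturb G₀ H t) Gb x (b l) - upsilon0 b G₀ Gb x (b l) = f l) :
    hcomp b H x = solve (ginv G₀ b x) τ κ f := by
  have hginv : ∀ μ ν, ginv G₀ b x μ ν = ginv G₀ b x ν μ := ginv_comm b hx hGs
  refine eq_of_sffVar_eq_of_gaugeVar_eq hτ hg00 hginv (fun μ ν ↦ hHs _ _) (solve_symm hκ)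
    (fun i j ↦ ?_) (fun l ↦ ?_)
  · rw [sffVar_solve hτ, ← apply_chrAt_perturb_sub_frame b hx hG hH hdt ht h0 htan, hK]
  · rw [gaugeVar_solve hτ hg00 hginv hκ, ← upsilon0_perturb_sub_frame b hx hG hH hdt ht h0 htan, hY]

/-! #### The printed normalisation: `e₀ = ν` the unit normal, `e_i ⊥ e₀` -/

omit [FiniteDimensional ℝ E] in
/-- The coordinate of `e₀` along a tangential dual vector vanishes. [folklore] -/
theorem coord_succ_basis_zero (i : Fin n) : b.coord i.succ (b 0) = 0 := by
  rw [Basis.coord_apply, Basis.repr_self, Finsupp.single_apply, if_neg (Fin.succ_ne_zero i).symm]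

omit [FiniteDimensional ℝ E] in
/-- The coordinate of `e₀` along its own dual vector is `1`. [folklore] -/
theorem coord_zero_basis_zero : b.coord 0 (b 0) = 1 := by
  rw [Basis.coord_apply, Basis.repr_self, Finsupp.single_apply, if_pos rfl]

/-- **`e₀ ⊥ e_i` forces `g^{i0} = 0`** (the inverse of a block-diagonal Gram matrix is block-diagonal).
[folklore] -/
theorem ginv_succ_zero (hx : (G₀ x).IsInvertible) (horth : ∀ i : Fin n, G₀ x (b 0) (b i.succ) = 0)
    (h00 : G₀ x (b 0) (b 0) ≠ 0) (i : Fin n) : ginv G₀ b x i.succ 0 = 0 := by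
  have h := coord_eq_sum_ginv b hx (b 0) i.succ
  rw [Fin.sum_univ_succ, coord_succ_basis_zero] at h
  simp only [horth, mul_zero, Finset.sum_const_zero, add_zero] at h
  exact (mul_eq_zero.mp h.symm).resolve_right h00

/-- … and `g^{0i} = 0` (symmetric `g₀`). [folklore] -/
theorem ginv_zero_succ (hx : (G₀ x).IsInvertible) (hGs : ∀ v w : E, G₀ x v w = G₀ x w v)
    (horth : ∀ i : Fin n, G₀ x (b 0) (b i.succ) = 0) (h00 : G₀ x (b 0) (b 0) ≠ 0) (i : Fin n) :
    ginv G₀ b x 0 i.succ = 0 := by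
  rw [ginv_comm b hx hGs, ginv_succ_zero b hx horth h00 i]

/-- **`g^{00} g₀(e₀,e₀) = 1`** when `e₀ ⊥ e_i`. [folklore] -/
theorem ginv_zero_zero_mul (hx : (G₀ x).IsInvertible)
    (horth : ∀ i : Fin n, G₀ x (b 0) (b i.succ) = 0) : ginv G₀ b x 0 0 * G₀ x (b 0) (b 0) = 1 := by
  have h := coord_eq_sum_ginv b hx (b 0) 0
  rw [Fin.sum_univ_succ, coord_zero_basis_zero] at h
  simp only [horth, mul_zero, Finset.sum_const_zero, add_zero] at h
  exact h.symm

/-- **Unit timelike normal** (`g₀(e₀,e₀) = −1`, signature `(−,+,+,+)`): `g^{00} = −1` — the `(g⁰)^{00}`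
implicit in Hintz's last two sentences (l.5766). [cite: Hintz2026, Prop 5.25 proof TeX l.5758, l.5766 (transcription; here proved)] -/
theorem ginv_zero_zero_eq_neg_one (hx : (G₀ x).IsInvertible)
    (horth : ∀ i : Fin n, G₀ x (b 0) (b i.succ) = 0) (hunit : G₀ x (b 0) (b 0) = -1) :
    ginv G₀ b x 0 0 = -1 := by
  have h := ginv_zero_zero_mul b hx horth
  rw [hunit] at h
  linarith

/-- **HV18: "`∇^{g₀}t_* ⊥ TΣ₀` is a non-zero scalar multiple of the unit normal vector `N`"** — in an
adapted frame with `e₀ ⊥ e_i`: `♯dt = (g^{00} τ) • e₀`. [cite: HintzVasy2018, Prop 3.10 (proof)] -/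
theorem sharpAt_dt_eq_smul (hx : (G₀ x).IsInvertible)
    (horth : ∀ i : Fin n, G₀ x (b 0) (b i.succ) = 0) (h00 : G₀ x (b 0) (b 0) ≠ 0)
    (h0 : dt (b 0) = τ) (htan : ∀ i : Fin n, dt (b i.succ) = 0) :
    sharpAt G₀ x dt = (ginv G₀ b x 0 0 * τ) • b 0 := by
  refine b.ext_elem fun μ ↦ ?_
  rw [← Basis.coord_apply, ← Basis.coord_apply, coord_sharpAt_eq_sum, Fin.sum_univ_succ, h0,
    map_smul, smul_eq_mul]
  simp only [htan, mul_zero, Finset.sum_const_zero, add_zero]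
  induction μ using Fin.cases with
  | zero => rw [coord_zero_basis_zero, mul_one]
  | succ i => rw [coord_succ_basis_zero, mul_zero, ginv_succ_zero b hx horth h00 i, zero_mul]

/-- … and that multiple is nonzero when `τ ≠ 0`. [cite: HintzVasy2018, Prop 3.10 (proof)] -/
theorem ginv_zero_zero_mul_ne_zero (hx : (G₀ x).IsInvertible)
    (horth : ∀ i : Fin n, G₀ x (b 0) (b i.succ) = 0) (hτ : τ ≠ 0) : ginv G₀ b x 0 0 * τ ≠ 0 := by
  have h := ginv_zero_zero_mul b hx horth
  refine mul_ne_zero (fun h0 ↦ ?_) hτ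
  rw [h0, zero_mul] at h
  exact zero_ne_one h

end Bridge

/-! ### §4 The printed orders: `(𝓔₀, ℓ₀)`-bookkeeping of Prop 5.25 and the Thm 13.1 Step 2 edge -/

section Orders

/-- A membership class `H_b^{∞,(𝓔₀ + shift, decay)}(Σ_IVP; …)` of Prop 5.25 (partially polyhomogeneous
at `∂Σ_IVP = Σ_IVP ∩ I⁰` with index set `𝓔₀` shifted by `shift ∈ ℕ` and conormal remainder of order
`r^{-decay}`), recorded by its two printed parameters only — an integer/real LEDGER of the proof's
function-space claims, not the spaces themselves (pattern of the `KlainermanSzeftel2021/*Ledger` modules).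
[cite: Hintz2026, Prop 5.25 TeX l.5719-5727 (transcription)] -/
structure PhgOrder where
  /-- the index-set shift `s` in `𝓔₀ + s` -/
  shift : ℕ
  /-- the remainder decay order `ℓ` -/
  decay : ℝ

namespace PhgOrder

/-- The class of the metric datum `γ̃` and of the OUTPUT `h₀, h₁`: `(𝓔₀, ℓ₀)` (l.5721, l.5727 eq. `EqExIDhj`).
[cite: Hintz2026, Prop 5.25 TeX l.5721, l.5727 (transcription)] -/
def ofData (ℓ₀ : ℝ) : PhgOrder := ⟨0, ℓ₀⟩

/-- The class of the second-fundamental-form datum `k̃`: `(𝓔₀ + 1, ℓ₀ + 1)` (l.5722).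
[cite: Hintz2026, Prop 5.25 TeX l.5722 (transcription)] -/
def ofDataK (ℓ₀ : ℝ) : PhgOrder := ⟨1, ℓ₀ + 1⟩

/-- One order GAINED: an `x`-derivative of a b-regular function, or a factor in `r⁻¹𝒞^∞`
("each `x`-derivative, arising in the computation of Christoffel symbols, gains one power of `r⁻¹`",
l.5751; the Kerr Christoffel symbols in `(t, x)` are `r⁻²𝒞^∞ ⊂ r⁻¹𝒞^∞`, Lemma 3.13 `LemmaKMetData`
proof l.3846). [cite: Hintz2026, Prop 5.25 proof TeX l.5751 (transcription)] -/
def gain (o : PhgOrder) : PhgOrder := ⟨o.shift + 1, o.decay + 1⟩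

/-- One order LOST: multiplication by `r` (`h₁ = r h̃₁`, l.5742). [cite: Hintz2026, Prop 5.25 proof TeX l.5742 (transcription)] -/
def mulR (o : PhgOrder) : PhgOrder := ⟨o.shift - 1, o.decay - 1⟩

/-- Unfolding lemma. [folklore] -/
@[simp] theorem ofData_shift (ℓ₀ : ℝ) : (ofData ℓ₀).shift = 0 := rfl
/-- Unfolding lemma. [folklore] -/
@[simp] theorem ofData_decay (ℓ₀ : ℝ) : (ofData ℓ₀).decay = ℓ₀ := rfl
/-- Unfolding lemma. [folklore] -/
@[simp] theorem ofDataK_shift (ℓ₀ : ℝ) : (ofDataK ℓ₀).shift = 1 := rfl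
/-- Unfolding lemma. [folklore] -/
@[simp] theorem ofDataK_decay (ℓ₀ : ℝ) : (ofDataK ℓ₀).decay = ℓ₀ + 1 := rfl
/-- Unfolding lemma. [folklore] -/
@[simp] theorem gain_shift (o : PhgOrder) : o.gain.shift = o.shift + 1 := rfl
/-- Unfolding lemma. [folklore] -/
@[simp] theorem gain_decay (o : PhgOrder) : o.gain.decay = o.decay + 1 := rfl
/-- Unfolding lemma. [folklore] -/
@[simp] theorem mulR_shift (o : PhgOrder) : o.mulR.shift = o.shift - 1 := rfl
/-- Unfolding lemma. [folklore] -/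
@[simp] theorem mulR_decay (o : PhgOrder) : o.mulR.decay = o.decay - 1 := rfl

/-- `k̃`'s class is `γ̃`'s class with one order gained. [cite: Hintz2026, Prop 5.25 TeX l.5721-5722 (transcription)] -/
theorem gain_ofData (ℓ₀ : ℝ) : (ofData ℓ₀).gain = ofDataK ℓ₀ := rfl

/-- The classes of the four printed right-hand-side terms of (5.x) `EqExIDk` (l.5749), in order:
`k̃` ∈ `(𝓔₀+1, ℓ₀+1)`; `h₀(∇^{g_{b₀}}_X Y, ν_{b₀})` = (datum class) × (Kerr Christoffel, one gain);
`g₀(∇^{g_{b₀}}_X Y, ν̃)` = (`ν̃ ∈ (𝓔₀,ℓ₀)`, l.5742) × (Kerr Christoffel, one gain);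
`g₀((∇^{g₀}_X − ∇^{g_{b₀}}_X)Y, ν)` = one `x`-derivative of `h₀` (one gain).
[cite: Hintz2026, Prop 5.25 proof TeX l.5742-5751 (transcription)] -/
def rhsTerms (ℓ₀ : ℝ) : List PhgOrder :=
  [ofDataK ℓ₀, (ofData ℓ₀).gain, (ofData ℓ₀).gain, (ofData ℓ₀).gain]

/-- **"the right-hand side here is … an element of `H_b^{∞,(𝓔₀+1,ℓ₀+1)}`"** (l.5751): every printed
term has exactly the class `(𝓔₀+1, ℓ₀+1)` by the ledger. [cite: Hintz2026, Prop 5.25 proof TeX l.5751 (claim under review; ledger arithmetic proved)] -/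
theorem rhsTerms_eq (ℓ₀ : ℝ) : ∀ o ∈ rhsTerms ℓ₀, o = ofDataK ℓ₀ := by
  intro o ho
  simp only [rhsTerms, List.mem_cons, List.not_mem_nil, or_false] at ho
  rcases ho with rfl | rfl | rfl | rfl <;> rfl

/-- The gauge right-hand side `−tr_{g₀}(∇^{g₀} − ∇^{g_{b₀}})` (l.5754–5756: "lies in
`H_b^{∞,(𝓔₀+1,ℓ₀+1)}`") is one `x`-derivative of `h₀`: the same class. [cite: Hintz2026, Prop 5.25 proof TeX l.5756 (claim under review; ledger arithmetic proved)] -/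
theorem gaugeRhs_eq (ℓ₀ : ℝ) : (ofData ℓ₀).gain = ofDataK ℓ₀ := rfl

/-- **`h̃₁ ∈ (𝓔₀+1, ℓ₀+1)` hence `h₁ = r h̃₁ ∈ (𝓔₀, ℓ₀)` = the claimed class (5.x) `EqExIDhj`**
(l.5727; the solve divides by `e₀ t ∈ 𝒞^∞ + H_b^{∞,(𝓔₀,ℓ₀)}` bounded away from `0`, l.5758, which the
text takes to preserve the class). [cite: Hintz2026, Prop 5.25 TeX l.5727, l.5742 (claim under review; ledger arithmetic proved)] -/
theorem mulR_ofDataK (ℓ₀ : ℝ) : (ofDataK ℓ₀).mulR = ofData ℓ₀ := by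
  simp [mulR, ofDataK, ofData]

/-- **Thm 13.1 Step 2 → Prop 5.25 (edge check)**: Step 2 (l.15124) invokes Prop 5.25 with
`ℓ₀ = 3 + ε₀`; Thm 13.1's hypothesis (13.x) `EqStMem` (l.15046–15049: `γ − γ_{b₀} ∈ H_b^{∞,(𝓔₀,3+ε₀)}`,
`k − k_{b₀} ∈ H_b^{∞,(𝓔₀+1,4+ε₀)}`) is EXACTLY Prop 5.25's data hypothesis at that `ℓ₀`, and Step 2's
claimed output class `H_b^{∞,(𝓔₀,3+ε₀)}` is Prop 5.25's (EqExIDhj).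
[cite: Hintz2026, Thm 13.1 TeX l.15046-15049 and Step 2 l.15124 (claim under review; bookkeeping proved)] -/
theorem step2_edge (ε₀ : ℝ) :
    ofData (3 + ε₀) = ⟨0, 3 + ε₀⟩ ∧ ofDataK (3 + ε₀) = ⟨1, 4 + ε₀⟩ := by
  refine ⟨rfl, ?_⟩
  simp only [ofDataK, PhgOrder.mk.injEq, true_and]
  ring

/-- Prop 5.25 asks `min Re 𝓔₀ > 0`; Thm 13.1 supplies `min Re 𝓔₀ > 1 + ε₀` with `ε₀ > 0` (l.15040).
[cite: Hintz2026, Thm 13.1 TeX l.15040 and Prop 5.25 l.5719 (bookkeeping proved)] -/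
theorem step2_minRe {ε₀ m : ℝ} (hε : 0 < ε₀) (hm : 1 + ε₀ < m) : 0 < m := by linarith

/-- The smallness index: Prop 5.25 wants `γ̃` small in `H_b^3` (l.5724, "so that `γ` is a Riemannian
metric"); Thm 13.1's (13.x) `EqStSmall` (l.15052) measures smallness in `H_b^{d,…}` with `d ∈ ℕ₀` chosen
by the theorem ("there exist `ε > 0`, `d ∈ ℕ₀`", l.15040) — compatible iff the chosen `d` is `≥ 3`.
[cite: Hintz2026, Prop 5.25 TeX l.5724; Thm 13.1 l.15040, l.15052 (transcription)] -/
def smallnessIndex : ℕ := 3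

/-- Any `d ≥ 3` serves. [folklore] -/
theorem step2_smallness {d : ℕ} (hd : smallnessIndex ≤ d) : 3 ≤ d := hd

end PhgOrder

end Orders

/-! ### §5 Hintz's index sets (Def 2.7 `DefTMIndex`) and the closure fact behind "nonlinearly closed" -/

section IndexSets

/-- **Index set** (Hintz Def 2.7 `DefTMIndex`, p.47, l.2360–2366): `𝓔 ⊂ ℂ × ℕ₀` with
`(z,k) ∈ 𝓔 ⟹ (z+j,k) ∈ 𝓔 ∀ j ∈ ℕ₀` and `(z,j) ∈ 𝓔 ∀ j ≤ k`, and only finitely many elements with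
`Re z ≤ C` for every real `C`. [cite: Hintz2026, Def 2.7 (DefTMIndex) TeX l.2360-2366 (transcription)] -/
structure IsIndexSet (𝓔 : Set (ℂ × ℕ)) : Prop where
  add_nat : ∀ z : ℂ, ∀ k : ℕ, (z, k) ∈ 𝓔 → ∀ j : ℕ, (z + j, k) ∈ 𝓔
  le_log : ∀ z : ℂ, ∀ k : ℕ, (z, k) ∈ 𝓔 → ∀ j ≤ k, (z, j) ∈ 𝓔
  finite_below : ∀ C : ℝ, {p ∈ 𝓔 | p.1.re ≤ C}.Finite

/-- **Sum of index sets** `𝓔 + 𝓕 := {(z+w, k+l)}` (l.2374–2377). [cite: Hintz2026, Def 2.7 (DefTMIndex)(4) TeX l.2374-2377 (transcription)] -/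
def isum (𝓔 𝓕 : Set (ℂ × ℕ)) : Set (ℂ × ℕ) :=
  {p | ∃ a ∈ 𝓔, ∃ c ∈ 𝓕, p = (a.1 + c.1, a.2 + c.2)}

/-- **Shift** `𝓔 + q := {(z+q, k)}` (l.2377). [cite: Hintz2026, Def 2.7 (DefTMIndex)(4) TeX l.2377 (transcription)] -/
def ishift (𝓔 : Set (ℂ × ℕ)) (q : ℂ) : Set (ℂ × ℕ) :=
  {p | ∃ a ∈ 𝓔, p = (a.1 + q, a.2)}

/-- **Multiples** `(j+1)𝓔`: `nfold 𝓔 0 = 𝓔`, `nfold 𝓔 (j+1) = nfold 𝓔 j + 𝓔` ("`2𝓔 := 𝓔 + 𝓔` and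
inductively `(j+1)𝓔 := j𝓔 + 𝓔`", l.2378). [cite: Hintz2026, Def 2.7 (DefTMIndex)(4) TeX l.2378 (transcription)] -/
def nfold (𝓔 : Set (ℂ × ℕ)) : ℕ → Set (ℂ × ℕ)
  | 0 => 𝓔
  | j + 1 => isum (nfold 𝓔 j) 𝓔

/-- **Nonlinearly closed** (l.2379: "We call `𝓔` with `min Re 𝓔 > 0` nonlinearly closed if `j𝓔 ⊂ 𝓔`
for all `j ∈ ℕ`") — the closure half; the positivity of `min Re 𝓔` is carried separately (it is a
hypothesis on the least exponent, vacuous for `𝓔 = ∅` by the convention `min Re ∅ = ∞`, l.2369).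
[cite: Hintz2026, Def 2.7 (DefTMIndex)(4) TeX l.2379 (transcription)] -/
def NonlinearlyClosed (𝓔 : Set (ℂ × ℕ)) : Prop := ∀ j : ℕ, nfold 𝓔 j ⊆ 𝓔

variable {𝓔 𝓕 : Set (ℂ × ℕ)}

/-- `𝓔 + 𝓔 ⊆ 𝓔` for a nonlinearly closed `𝓔` (`j = 2`). [folklore] -/
theorem isum_self_subset (h : NonlinearlyClosed 𝓔) : isum 𝓔 𝓔 ⊆ 𝓔 := h 1

/-- `(𝓔 + q) + 𝓕 = (𝓔 + 𝓕) + q`. [folklore] -/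
theorem isum_ishift_left (q : ℂ) : isum (ishift 𝓔 q) 𝓕 = ishift (isum 𝓔 𝓕) q := by
  ext p
  constructor
  · rintro ⟨a, ⟨a', ha', rfl⟩, c, hc, rfl⟩
    exact ⟨(a'.1 + c.1, a'.2 + c.2), ⟨a', ha', c, hc, rfl⟩, by simp [add_right_comm]⟩
  · rintro ⟨d, ⟨a', ha', c, hc, rfl⟩, rfl⟩
    exact ⟨(a'.1 + q, a'.2), ⟨a', ha', rfl⟩, c, hc, by simp [add_right_comm]⟩

/-- **The product rule behind l.5751**: a factor of class `𝓔₀ + 1` times a factor of class `𝓔₀` has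
exponents in `(𝓔₀ + 1) + 𝓔₀ ⊆ 𝓔₀ + 1` when `𝓔₀` is nonlinearly closed — which is how "the assumption
that `𝓔₀` is nonlinearly closed" makes the right-hand side of (EqExIDk) an element of the
`(𝓔₀+1, ℓ₀+1)` class. [cite: Hintz2026, Prop 5.25 proof TeX l.5751 (claim under review; index-set half proved)] -/
theorem isum_ishift_subset (h : NonlinearlyClosed 𝓔) (q : ℂ) : isum (ishift 𝓔 q) 𝓔 ⊆ ishift 𝓔 q := by
  rw [isum_ishift_left]
  rintro p ⟨d, hd, rfl⟩
  exact ⟨d, isum_self_subset h hd, rfl⟩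

/-- More decay is fewer constraints: `𝓔 + (q+1) ⊆ 𝓔 + q` for an index set. [folklore] -/
theorem ishift_add_one_subset (h𝓔 : IsIndexSet 𝓔) (q : ℂ) : ishift 𝓔 (q + 1) ⊆ ishift 𝓔 q := by
  rintro p ⟨a, ha, rfl⟩
  refine ⟨(a.1 + 1, a.2), ?_, by simp only [Prod.mk.injEq, and_true]; ring⟩
  have := h𝓔.add_nat a.1 a.2 (by simpa using ha) 1
  simpa using this

/-- The EMPTY index set is an index set and is nonlinearly closed — the case of Example 5.27
`ExIDPhg` (1)/(2) ("Such data satisfy the asymptotic conditions of Proposition 5.25 for `𝓔₀ = ∅` and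
all `ℓ₀`", l.5829). [cite: Hintz2026, Example 5.27 (ExIDPhg)(1) TeX l.5829 (claim under review; here proved)] -/
theorem isIndexSet_empty : IsIndexSet (∅ : Set (ℂ × ℕ)) where
  add_nat := by simp
  le_log := by simp
  finite_below := fun C ↦ by simp

/-- `nfold ∅ j = ∅`. [folklore] -/
theorem nfold_empty (j : ℕ) : nfold (∅ : Set (ℂ × ℕ)) j = ∅ := by
  induction j with
  | zero => rfl
  | succ j ih => simp [nfold, isum]

/-- `∅` is nonlinearly closed. [folklore] -/
theorem nonlinearlyClosed_empty : NonlinearlyClosed (∅ : Set (ℂ × ℕ)) := fun j ↦ by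
  rw [nfold_empty]

end IndexSets

end Hintz2026.GaugedCauchyData

end Literature.Geometry.Lorentzian
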